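import Summits.AtomisticToContinuum.FouriersLaw.Theorems.BondHeatUncertaintySubdiffusiveBondHeatJunctionRatioRootContact

/-!
# `JunctionRatioRootContactFrames` — file 18b: ABSORPTION OF THE ROOT SLACK, the global root contact laws and the FRAMES BY NAME
# (cell `decomp-a2c`, lens-1 «grading / quantitative ladder», gen 62, re-emitted gen 63; second half of file 18, beneath file 18a
# `…JunctionRatioRootContact` = the root contact laws `RootPositivityAt` [RP_d] / `RootThermalisationAt` [RT_d], the root junction inequality
# `RatioJunctionRootAt` and the seam `ratioJunctionRootAt_of_rootPeeled`; target 11071)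

Absorption (PROVED): in RESISTANCE currency `r_n = 1/E_n` the root slack of `RatioJunctionRootAt … ρ b c L₀`
(`ρ·(1/E_u + 1/E_v) − b − c/√E_N ≤ 1/E_N`, `N = u + L₀ + v`) reads `c·√r_N` and is eaten by the one-good-scale mechanism of file 15a —
`escapeSmall_of_ratioJunctionRootAt` (one scale `u⋆` with `E_{u⋆}` small propagates through the root inequality to `E_n ≤ η` for ALL large `n`:
`liminf = 0 ⟹ lim = 0` under any positive root rung) and `ratioJunctionAt_of_root : RatioJunctionRootAt ρ b c ∧ (liminf_n E_n = 0) ⟹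
RatioJunctionAt ρ' (max b 0)` for every `ρ' < ρ`; then file 15a's `ratioJunctionAt_absorb` removes the budget.
Global laws: `RootPositivity d`, `RootThermalisation d` (`∀` parameters, `T > 0`, `∃ C`, the `…At` law); `d = 0` PROVED (`rootPositivity_zero`,
`rootThermalisation_zero`); `rootPositivity_of_contactPositivity` (file 17a's node factors through this one), `rootPositivity_of_rootThermalisation`.
Frames by name: `seriesRatioLaw_of_rootPeeled_of_escapeInfZero`, `asymptoticSeriesLaw_of_rootPeeled_of_escapeInfZero`
(`(∀ ρ < 1, PeeledLocalityLaw ρ d) ∧ RootPositivity d ∧ EscapeInfZero ⟹ AsymptoticSeriesLaw`),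
`boundedResponse_of_rootPeeled_of_escapeInfZero_of_subOhmicBootstrap` (11071 BY NAME), `asymptoticSeriesLaw_of_rootPeeled_of_nonBallistic`
(floor partner named as the route item `NonBallistic`, stmt-9127) and `escapeVanishing_of_rootPeeled_of_escapeInfZero` (by-product: under the
node's hypotheses `EscapeInfZero` upgrades to `EscapeVanishing`, so file 17a's converse frame costs nothing extra).  NET EFFECT ON THE NODE OF
RECORD: the contact side condition of the peeled door drops from [NFO_d] (exact sign; IDEA-NEEDED: a first-order maximum principle) to [RP_d]
(root slack; ATTACKABLE: entropy production + commutator transfer, file 18a docstring), at no cost on the 11071 side; all 11071-content stays in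
[PBL] (`ρ > 1/2`).
No `sorry`; standard axioms; imports only file 18a.
-/

noncomputable section

open MeasureTheory Filter Topology Set
open scoped BigOperators

namespace Summit.AtomisticToContinuum.FouriersLaw.Theorems.SubdiffusiveBondHeat

namespace EscapeGrading

open Literature.MathematicalPhysics.KineticTheory.HeatConduction
open Summit.AtomisticToContinuum.FouriersLaw.Theses.BondHeatUncertainty (BoundedResponse NonBallistic)
open Summit.AtomisticToContinuum.FouriersLaw.Theorems.SubdiffusiveBondHeat.JunctionDefectGrading

/-! ## D. Absorption of the root slack: one good scale -/

/-- **One good scale propagates through the root inequality:** `RatioJunctionRootAt ρ b c L₀` with `ρ > 0` and `liminf_n E_n = 0` give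
`E_n ≤ η` for ALL large `n`, every `η > 0`.  Pick `u⋆` with `ρ·r_{u⋆} ≥ 1/η + c⁺/√η + b⁺ + 1`; for `n = u⋆ + L₀ + v`, `v` large:
`r_n ≥ ρ·r_{u⋆} − b − c/√E_n`, and `E_n > η` would give `c/√E_n ≤ c⁺/√η`, hence `r_n > 1/η`, a contradiction. [this file] -/
theorem escapeSmall_of_ratioJunctionRootAt {ω₂ lam β γ T ρ b c : ℝ} {L₀ : ℕ} (hω : 0 < ω₂) (hl : 0 < lam) (hβ : 0 < β)
    (hγ : 0 < γ) (hT : 0 < T) (hρ : 0 < ρ) (hJ : RatioJunctionRootAt ω₂ lam β γ T ρ b c L₀)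
    (hI : ∀ η : ℝ, 0 < η → ∀ M : ℕ, ∃ n : ℕ, M ≤ n ∧ escapeDeficit ω₂ lam β γ T n ≤ η) :
    ∀ η : ℝ, 0 < η → ∃ N₃ : ℕ, ∀ n : ℕ, N₃ ≤ n → escapeDeficit ω₂ lam β γ T n ≤ η := by
  intro η hη
  obtain ⟨N₂, hJ⟩ := hJ
  have hpos : ∀ n : ℕ, 2 ≤ n → 0 < escapeDeficit ω₂ lam β γ T n := fun n hn => escapeDeficit_pos hω hl hβ hγ hT hn
  have hcp0 : 0 ≤ max c 0 := le_max_right _ _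
  have hbp0 : 0 ≤ max b 0 := le_max_right _ _
  have hsη : 0 < Real.sqrt η := Real.sqrt_pos.2 hη
  -- the target resistance level and one good scale `u⋆`
  set K : ℝ := 1 / η + max c 0 / Real.sqrt η + max b 0 + 1 with hK
  have hKpos : 0 < K := by positivity
  obtain ⟨us, hus, hEus⟩ := hI (ρ / K) (by positivity) (max N₂ 2)
  have hus2 : 2 ≤ us := le_trans (le_max_right _ _) hus
  have husN : N₂ ≤ us := le_trans (le_max_left _ _) hus
  have hEus_pos := hpos us hus2
  have hrus : K ≤ ρ * (1 / escapeDeficit ω₂ lam β γ T us) := by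
    rw [mul_one_div, le_div_iff₀ hEus_pos]
    calc K * escapeDeficit ω₂ lam β γ T us ≤ K * (ρ / K) := mul_le_mul_of_nonneg_left hEus hKpos.le
      _ = ρ := by field_simp
  refine ⟨us + L₀ + max N₂ 2, fun n hn => ?_⟩
  have h22 : 2 ≤ max N₂ 2 := le_max_right _ _
  have hm : max N₂ 2 ≤ n - (us + L₀) := by omega
  have hsplit : us + L₀ + (n - (us + L₀)) = n := by omega
  have h := hJ us (n - (us + L₀)) husN (le_trans (le_max_left _ _) hm)
  rw [hsplit] at h
  have hEn := hpos n (by omega)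
  have hrm : 0 ≤ 1 / escapeDeficit ω₂ lam β γ T (n - (us + L₀)) :=
    (one_div_pos.2 (hpos _ (le_trans h22 hm))).le
  by_contra hcon
  push Not at hcon
  have hsn : Real.sqrt η ≤ Real.sqrt (escapeDeficit ω₂ lam β γ T n) := Real.sqrt_le_sqrt hcon.le
  have hsnpos : 0 < Real.sqrt (escapeDeficit ω₂ lam β γ T n) := lt_of_lt_of_le hsη hsn
  have hc1 : c / Real.sqrt (escapeDeficit ω₂ lam β γ T n) ≤ max c 0 / Real.sqrt (escapeDeficit ω₂ lam β γ T n) :=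
    div_le_div_of_nonneg_right (le_max_left _ _) hsnpos.le
  have hc2 : max c 0 / Real.sqrt (escapeDeficit ω₂ lam β γ T n) ≤ max c 0 / Real.sqrt η :=
    div_le_div_of_nonneg_left hcp0 hsη hsn
  have hr : 1 / escapeDeficit ω₂ lam β γ T n < 1 / η := one_div_lt_one_div_of_lt hη hcon
  have hb : b ≤ max b 0 := le_max_left _ _
  have hρv : 0 ≤ ρ * (1 / escapeDeficit ω₂ lam β γ T (n - (us + L₀))) := mul_nonneg hρ.le hrm
  have hK' : K ≤ 1 / escapeDeficit ω₂ lam β γ T n + max b 0 + max c 0 / Real.sqrt η := by linarith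
  rw [hK] at hK'
  linarith

/-- **Absorbing the root slack: `RatioJunctionRootAt ρ b c L₀ ∧ (liminf_n E_n = 0) ⟹ RatioJunctionAt ρ' (max b 0) L₀` for every `ρ' < ρ`.**
Beyond the scale where `√E_N ≤ (ρ − ρ')/(ρ'(c⁺ + 1))` (`escapeSmall_of_ratioJunctionRootAt`), `ρ'·c⁺/√E_N ≤ (ρ − ρ')/E_N`, so
`ρ'·ρ·(r_u + r_v) ≤ ρ'·(r_N + b⁺ + c⁺/√E_N) ≤ ρ·(r_N + b⁺)`. [this file] -/
theorem ratioJunctionAt_of_root {ω₂ lam β γ T ρ ρ' b c : ℝ} {L₀ : ℕ} (hω : 0 < ω₂) (hl : 0 < lam) (hβ : 0 < β) (hγ : 0 < γ)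
    (hT : 0 < T) (hρ' : ρ' < ρ) (hJ : RatioJunctionRootAt ω₂ lam β γ T ρ b c L₀)
    (hI : ∀ η : ℝ, 0 < η → ∀ M : ℕ, ∃ n : ℕ, M ≤ n ∧ escapeDeficit ω₂ lam β γ T n ≤ η) :
    RatioJunctionAt ω₂ lam β γ T ρ' (max b 0) L₀ := by
  have hpos : ∀ n : ℕ, 2 ≤ n → 0 < escapeDeficit ω₂ lam β γ T n := fun n hn => escapeDeficit_pos hω hl hβ hγ hT hn
  have hbp0 : 0 ≤ max b 0 := le_max_right _ _
  have hb : b ≤ max b 0 := le_max_left _ _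
  rcases le_or_gt ρ' 0 with hρ'0 | hρ'0
  · -- `ρ' ≤ 0`: the left-hand side is nonpositive
    refine ⟨2, fun u v hu hv => ?_⟩
    have hEu := hpos u hu
    have hEv := hpos v hv
    have hEN := hpos (u + L₀ + v) (by omega)
    have hsum : 0 ≤ 1 / escapeDeficit ω₂ lam β γ T u + 1 / escapeDeficit ω₂ lam β γ T v := by positivity
    have h1 : ρ' * (1 / escapeDeficit ω₂ lam β γ T u + 1 / escapeDeficit ω₂ lam β γ T v) ≤ 0 :=
      mul_nonpos_of_nonpos_of_nonneg hρ'0 hsum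
    have h2 : 0 ≤ 1 / escapeDeficit ω₂ lam β γ T (u + L₀ + v) := by positivity
    linarith
  -- `0 < ρ' < ρ`
  have hρ : 0 < ρ := lt_trans hρ'0 hρ'
  have hgap : 0 < ρ - ρ' := by linarith
  have hcp0 : 0 ≤ max c 0 := le_max_right _ _
  have hc : c ≤ max c 0 := le_max_left _ _
  obtain ⟨N₂, hJ'⟩ := id hJ
  set t : ℝ := (ρ - ρ') / (ρ' * (max c 0 + 1)) with ht_def
  have ht : 0 < t := div_pos hgap (by positivity)
  obtain ⟨N₃, hN₃⟩ := escapeSmall_of_ratioJunctionRootAt hω hl hβ hγ hT hρ hJ hI (t ^ 2) (by positivity)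
  refine ⟨max (max N₂ N₃) 2, fun u v hu hv => ?_⟩
  have huN : N₂ ≤ u := le_trans (le_trans (le_max_left _ _) (le_max_left _ _)) hu
  have hvN : N₂ ≤ v := le_trans (le_trans (le_max_left _ _) (le_max_left _ _)) hv
  have huN₃ : N₃ ≤ u := le_trans (le_trans (le_max_right _ _) (le_max_left _ _)) hu
  have hu2 : 2 ≤ u := le_trans (le_max_right _ _) hu
  have hv2 : 2 ≤ v := le_trans (le_max_right _ _) hv
  have h := hJ' u v huN hvN
  have hsmall := hN₃ (u + L₀ + v) (by omega)
  set EN := escapeDeficit ω₂ lam β γ T (u + L₀ + v) with hEN_def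
  set Eu := escapeDeficit ω₂ lam β γ T u with hEu_def
  set Ev := escapeDeficit ω₂ lam β γ T v with hEv_def
  have hENpos : 0 < EN := hpos (u + L₀ + v) (by omega)
  have hEu : 0 < Eu := hpos u hu2
  have hEv : 0 < Ev := hpos v hv2
  set s := Real.sqrt EN with hs_def
  have hs : 0 < s := Real.sqrt_pos.2 hENpos
  have hsE : s * s = EN := Real.mul_self_sqrt hENpos.le
  have hst : s ≤ t := by
    have h1 : s ≤ Real.sqrt (t ^ 2) := Real.sqrt_le_sqrt hsmall
    rwa [Real.sqrt_sq ht.le] at h1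
  -- threshold consequence: `ρ'·(c⁺ + 1)·s ≤ ρ − ρ'`
  have hthr : ρ' * (max c 0 + 1) * s ≤ ρ - ρ' := by
    have h1 : ρ' * (max c 0 + 1) * s ≤ ρ' * (max c 0 + 1) * t := mul_le_mul_of_nonneg_left hst (by positivity)
    have h2 : ρ' * (max c 0 + 1) * t = ρ - ρ' := by
      rw [ht_def]
      field_simp
    linarith
  have hA : 0 ≤ 1 / Eu + 1 / Ev := by positivity
  have h1 : ρ * (1 / Eu + 1 / Ev) ≤ 1 / EN + max b 0 + max c 0 / s := by
    have hc1 : c / s ≤ max c 0 / s := div_le_div_of_nonneg_right hc hs.le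
    linarith
  have h2 : ρ' * (max c 0 / s) ≤ (ρ - ρ') * (1 / EN) := by
    rw [← hsE]
    have e1 : ρ' * (max c 0 / s) = (ρ' * max c 0 * s) / (s * s) := by
      field_simp
    have e2 : (ρ - ρ') * (1 / (s * s)) = (ρ - ρ') / (s * s) := by ring
    rw [e1, e2]
    apply div_le_div_of_nonneg_right _ (mul_pos hs hs).le
    nlinarith [mul_nonneg hρ'0.le hs.le]
  have h3 : ρ' * (ρ * (1 / Eu + 1 / Ev)) ≤ ρ' * (1 / EN + max b 0 + max c 0 / s) := mul_le_mul_of_nonneg_left h1 hρ'0.le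
  have h4 : ρ' * max b 0 ≤ ρ * max b 0 := mul_le_mul_of_nonneg_right hρ'.le hbp0
  have h5 : ρ * (ρ' * (1 / Eu + 1 / Ev) - max b 0) ≤ ρ * (1 / EN) := by
    have e : ρ * (ρ' * (1 / Eu + 1 / Ev) - max b 0) = ρ' * (ρ * (1 / Eu + 1 / Ev)) - ρ * max b 0 := by ring
    rw [e]
    linarith
  exact le_of_mul_le_mul_left h5 hρ

/-! ## E. Global laws and the frames by name -/

/-- **Root positivity at depth `d + 1`** (global): for all parameters and `T > 0` there is `C` with `RootPositivityAt … C d`.  Depth one is a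
theorem (`rootPositivity_zero`); implied by `ContactPositivity d` and by `RootThermalisation d`. [piece · root positivity] -/
def RootPositivity (d : ℕ) : Prop :=
  ∀ ω₂ lam β γ : ℝ, 0 < ω₂ → 0 < lam → 0 < β → 0 < γ → ∀ T : ℝ, 0 < T → ∃ C : ℝ, RootPositivityAt ω₂ lam β γ T C d

/-- **Root thermalisation at depth `d + 1`** (global): for all parameters and `T > 0` there is `C` with `RootThermalisationAt … C d` — the
grade-½ contact share; the statement the transfer mechanism proves. [attack target · grade-½ share] -/
def RootThermalisation (d : ℕ) : Prop :=
  ∀ ω₂ lam β γ : ℝ, 0 < ω₂ → 0 < lam → 0 < β → 0 < γ → ∀ T : ℝ, 0 < T → ∃ C : ℝ, RootThermalisationAt ω₂ lam β γ T C d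

/-- `ContactPositivity d ⟹ RootPositivity d` (`C = 0`): file 17a's node factors through this file's. [folklore] -/
theorem rootPositivity_of_contactPositivity {d : ℕ} (h : ContactPositivity d) : RootPositivity d :=
  fun ω₂ lam β γ hω hl hβ hγ T hT => ⟨0, rootPositivityAt_of_contactPositivityAt le_rfl (h ω₂ lam β γ hω hl hβ hγ T hT)⟩

/-- `RootThermalisation d ⟹ RootPositivity d`. [folklore] -/
theorem rootPositivity_of_rootThermalisation {d : ℕ} (h : RootThermalisation d) : RootPositivity d :=
  fun ω₂ lam β γ hω hl hβ hγ T hT => by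
    obtain ⟨C, hC⟩ := h ω₂ lam β γ hω hl hβ hγ T hT
    exact ⟨C, rootPositivityAt_of_rootThermalisationAt hC⟩

/-- `RootThermalisation 0` (`C = 1`). [this file] -/
theorem rootThermalisation_zero : RootThermalisation 0 := fun _ _ _ _ hω hl hβ hγ _ hT =>
  ⟨1, rootThermalisationAt_one_zero hω hl hβ hγ hT⟩

/-- `RootPositivity 0`. [this file] -/
theorem rootPositivity_zero : RootPositivity 0 :=
  rootPositivity_of_contactPositivity contactPositivity_zero

/-- **THE ROOT-PEELED DOOR, per rung: `RootPositivity d ∧ PeeledLocalityLaw ρ d ∧ EscapeInfZero ⟹ SeriesRatioLaw ρ'` for every `ρ' < ρ`** —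
seam, root absorption at the ratio `(ρ + ρ')/2`, then file 15a's budget absorption. [this file · frame] -/
theorem seriesRatioLaw_of_rootPeeled_of_escapeInfZero {ρ ρ' : ℝ} {d : ℕ} (hρ' : ρ' < ρ) (hP : RootPositivity d)
    (hL : PeeledLocalityLaw ρ d) (hI : EscapeInfZero) : SeriesRatioLaw ρ' := by
  intro ω₂ lam β γ hω hl hβ hγ T hT
  obtain ⟨C, hC⟩ := hP ω₂ lam β γ hω hl hβ hγ T hT
  obtain ⟨b, L₀, hE, hB⟩ := hL ω₂ lam β γ hω hl hβ hγ T hT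
  have hJ := ratioJunctionRootAt_of_rootPeeled hω hl hβ hγ hT hC hE hB
  have hI' := hI ω₂ lam β γ hω hl hβ hγ T hT
  have hm1 : (ρ + ρ') / 2 < ρ := by linarith
  have hm2 : ρ' < (ρ + ρ') / 2 := by linarith
  have hJ' := ratioJunctionAt_of_root hω hl hβ hγ hT hm1 hJ hI'
  obtain ⟨N₂, h⟩ := ratioJunctionAt_absorb hω hl hβ hγ hT hm2 hJ' hI'
  exact ⟨L₀, N₂, fun u v hu hv => by simpa using h u v hu hv⟩

/-- **THE ROOT-PEELED DOOR INTO `AsymptoticSeriesLaw`: `(∀ ρ < 1, PeeledLocalityLaw ρ d) ∧ RootPositivity d ∧ EscapeInfZero ⟹ AsymptoticSeriesLaw`**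
(take `ρ = (1 + ρ')/2`). [frame] -/
theorem asymptoticSeriesLaw_of_rootPeeled_of_escapeInfZero {d : ℕ} (hL : ∀ ρ : ℝ, ρ < 1 → PeeledLocalityLaw ρ d)
    (hP : RootPositivity d) (hI : EscapeInfZero) : AsymptoticSeriesLaw := fun ρ' hρ' =>
  seriesRatioLaw_of_rootPeeled_of_escapeInfZero (ρ := (1 + ρ') / 2) (by linarith) hP (hL _ (by linarith)) hI

/-- **The four-piece node, by name: `(∀ ρ < 1, PeeledLocalityLaw ρ d) ∧ RootPositivity d ∧ EscapeInfZero ∧ SubOhmicBootstrap ⟹ BoundedResponse`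
(11071).** [frame] -/
theorem boundedResponse_of_rootPeeled_of_escapeInfZero_of_subOhmicBootstrap {d : ℕ}
    (hL : ∀ ρ : ℝ, ρ < 1 → PeeledLocalityLaw ρ d) (hP : RootPositivity d) (hI : EscapeInfZero) (hB : SubOhmicBootstrap) :
    BoundedResponse :=
  boundedResponse_of_asymptoticSeriesLaw_of_subOhmicBootstrap (asymptoticSeriesLaw_of_rootPeeled_of_escapeInfZero hL hP hI) hB

/-- The node with the floor partner named as the route item `NonBallistic` (stmt-9127; `escapeInfZero_iff_nonBallistic`). [frame] -/
theorem asymptoticSeriesLaw_of_rootPeeled_of_nonBallistic {d : ℕ} (hL : ∀ ρ : ℝ, ρ < 1 → PeeledLocalityLaw ρ d)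
    (hP : RootPositivity d) (hN : NonBallistic) : AsymptoticSeriesLaw :=
  asymptoticSeriesLaw_of_rootPeeled_of_escapeInfZero hL hP (escapeInfZero_iff_nonBallistic.2 hN)

/-- **By-product: ONE positive peeled rung upgrades `liminf` to `lim`** — `RootPositivity d ∧ PeeledLocalityLaw ρ d` (`ρ > 0`) `∧ EscapeInfZero ⟹
EscapeVanishing` (≡ `NoBallisticChannel` 28286).  Hence under this node's hypotheses the extra hypothesis `EscapeVanishing` of file 17a's converse
frame `peeledLocalityLaw_of_relativeLocalityLaw` is free. [this file · frame] -/
theorem escapeVanishing_of_rootPeeled_of_escapeInfZero {ρ : ℝ} {d : ℕ} (hρ : 0 < ρ) (hP : RootPositivity d)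
    (hL : PeeledLocalityLaw ρ d) (hI : EscapeInfZero) : EscapeVanishing := by
  intro ω₂ lam β γ hω hl hβ hγ T hT
  obtain ⟨C, hC⟩ := hP ω₂ lam β γ hω hl hβ hγ T hT
  obtain ⟨b, L₀, hE, hB⟩ := hL ω₂ lam β γ hω hl hβ hγ T hT
  have hJ := ratioJunctionRootAt_of_rootPeeled hω hl hβ hγ hT hC hE hB
  have hsmall := escapeSmall_of_ratioJunctionRootAt hω hl hβ hγ hT hρ hJ (hI ω₂ lam β γ hω hl hβ hγ T hT)
  have hpos : ∀ n : ℕ, 2 ≤ n → 0 < escapeDeficit ω₂ lam β γ T n := fun n hn => escapeDeficit_pos hω hl hβ hγ hT hn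
  refine tendsto_order.2 ⟨fun a ha => ?_, fun a ha => ?_⟩
  · exact eventually_atTop.2 ⟨2, fun n hn => lt_of_lt_of_le ha (hpos n hn).le⟩
  · obtain ⟨N₃, hN₃⟩ := hsmall (a / 2) (by positivity)
    exact eventually_atTop.2 ⟨N₃, fun n hn => lt_of_le_of_lt (hN₃ n hn) (by linarith)⟩

end EscapeGrading

end Summit.AtomisticToContinuum.FouriersLaw.Theorems.SubdiffusiveBondHeat

end
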